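import Mathlib
import HarnessLib
import Literature.MathematicalPhysics.QuantumLattice.FermiRG.BGM2003Sectors
import Summits.HubbardSuperconductivity.HubbardSuperconductivity.Theorems.KLProgrammeAbsUmklappClassCount
import Summits.HubbardSuperconductivity.HubbardSuperconductivity.Theorems.KLProgrammeAbsUmklappClassFibrePred

/-!
# Route `KLProgramme` — K3 engine (stmt-HubbardSuperconductivity-20437), stub (b) (ℓ)/(I2)–(I3), located item «ABS-UMK-COUNT»:
# the COUNT OF ONE NARROW CLASS WITH A PRESCRIBED SET OF LEGS — `≤ T_bound · N · K₀^{L − |E| − 4}`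

Cell gate-hubbard-kl, seat p4 g15 (prescribed-set generalisation of `card_narrowClass_le`, towards the exponent `L − |E| − 2` of
`BGM2003.count_target_wide_prescribed` for the narrow bundles).  The anchored leg `i₁` of …ClassCount becomes a set `E` of legs with prescribed labels `τ|_E`;
the base leg `s` and the kept triple `a, b, c` are free (`∉ E`); narrowness is asked of the free legs only.  The projection zeroing the kept legs lands in a
union over `ω_s` of coordinate products with singletons at `s, a, b, c` and on `E`, and cones at the `L − |E| − 4` sliced free legs; the fibres are bounded
by `card_classFibre_le_pred`:

* **`card_narrowClass_prescribed_le`** — `#class ≤ T_bound · N · K₀^{L − |E| − 4}`.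

Everything is PROVED; no definitions, no named facts. [cite: BenfattoGiulianiMastropietro2003, §7.4 (s1.23)–(s1.25a) p.28 (L33–52)]
-/

noncomputable section

open Real Set
open Literature.MathematicalPhysics.QuantumLattice Literature.MathematicalPhysics.QuantumLattice.FermiRG
open Literature.MathematicalPhysics.QuantumLattice.FermiRG.BGM2003
open Summit.HubbardSuperconductivity.HubbardSuperconductivity.Theorems.ThinLevelSet
open Summit.HubbardSuperconductivity.HubbardSuperconductivity.Theorems

namespace Summit.HubbardSuperconductivity.HubbardSuperconductivity.Theorems.AbsUmklappCount

set_option linter.dupNamespace false -- summit = problem name (single-conjunct summit), D-0017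

/-! ## §1 The count of one narrow class with a prescribed set of legs -/

open Classical in
/-- **The count of one narrow class with a PRESCRIBED set of legs**: strings agreeing with `τ` on `E`, free legs (`∉ E`) pairwise within pair angle `Φ₀`,
kept triple `a, b, c ∉ E` within torus distance `2Φ₀` of `θ_{n′,ω_s} + σ` (`s ∉ E`), momenta summing to `R`: at most `T_bound · N · K₀^{L − |E| − 4}`. [cite: BenfattoGiulianiMastropietro2003, §7.4 (s1.23)–(s1.25a) p.28 (L33–52)] -/
theorem card_narrowClass_prescribed_le {ε : (Fin 2 → ℝ) → ℝ} {μ e₀ : ℝ} {u : ℝ → ℝ → ℝ} (hD : DispersionHyp ε μ e₀ u) {c₃ : ℝ} (hc₃ : 0 < c₃)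
    (h73 : ∀ (n ω : ℕ), ω < sectorCount n → ∀ p ∈ sSector u e₀ n ω,
      ∃ k₁ k₂ : ℝ,
        p = fermiPoint u (sectorCenter n ω) + k₁ • unitNormal u (sectorCenter n ω) 0 +
              k₂ • unitTangent u (sectorCenter n ω) 0 ∧
        |k₁| ≤ c₃ * (4 : ℝ) ^ (-(n : ℤ)) ∧ |k₂| ≤ c₃ * (2 : ℝ) ^ (-(n : ℤ)) ∧
        |fderiv ℝ ε p (unitTangent u (sectorCenter n ω) 0)| ≤ c₃ * (2 : ℝ) ^ (-(n : ℤ)))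
    {s₁ Φ cf Af Bf M₁ : ℝ} (hs₁ : 0 < s₁) (hM₁ : 0 ≤ M₁) (hΦ : 0 < Φ) (hcf : 0 < cf) (hcfA : cf ≤ Af) (hBf : 0 ≤ Bf)
    (hchart : ∀ θs : ℝ, ∃ f f' f'' : ℝ → ℝ, Measurable f ∧
        (∀ φ ∈ Icc (-Φ) Φ,
          f ((fermiPoint u (θs + φ) - fermiPoint u θs) ⬝ᵥ tdir θs) = -((fermiPoint u (θs + φ) - fermiPoint u θs) ⬝ᵥ dir θs)) ∧
        (∀ y ∈ Icc (-(s₁ / 4 * Φ)) (s₁ / 4 * Φ), HasDerivAt f (f' y) y ∧ HasDerivAt f' (f'' y) y ∧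
          cf ≤ f'' y ∧ f'' y ≤ Af ∧ |f' y| ≤ Bf) ∧
        (∀ φ ∈ Icc (-Φ) Φ, ∀ φ' ∈ Icc (-Φ) Φ,
          s₁ / 2 * |φ - φ'| ≤ |(fermiPoint u (θs + φ) - fermiPoint u θs) ⬝ᵥ tdir θs - (fermiPoint u (θs + φ') - fermiPoint u θs) ⬝ᵥ tdir θs| ∧
          |(fermiPoint u (θs + φ) - fermiPoint u θs) ⬝ᵥ tdir θs - (fermiPoint u (θs + φ') - fermiPoint u θs) ⬝ᵥ tdir θs| ≤ M₁ * |φ - φ'|) ∧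
        (fermiPoint u (θs + 0) - fermiPoint u θs) ⬝ᵥ tdir θs = 0)
    {n' L : ℕ} (E : Finset (Fin L)) (τ : Fin L → Fin (sectorCount n')) (s a b c : Fin L)
    (hsE : s ∉ E) (haE : a ∉ E) (hbE : b ∉ E) (hcE : c ∉ E)
    (hsa : s ≠ a) (hsb : s ≠ b) (hsc : s ≠ c) (hab : a ≠ b) (hac : a ≠ c) (hbc : b ≠ c)
    (R : Fin 2 → ℝ) {Φ₀ : ℝ} (hΦ₀ : 0 ≤ Φ₀) (h2Φ₀ : 2 * Φ₀ ≤ Φ) (σ : ℝ)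
    (hreg : 6 * (M₁ * (2 * Φ₀)) + 3 * (L * (4 * c₃ * (2 : ℝ) ^ (-(n' : ℤ)))) + 2 * (s₁ / 2 * sectorWidth n') ≤ s₁ / 4 * Φ) :
    ((((Finset.univ : Finset (Fin L → Fin (sectorCount n'))).filter fun ω =>
        ((∀ e ∈ E, ω e = τ e) ∧ (∀ i j : Fin L, i ∉ E → j ∉ E → pairAngle (sectorCenter n' (ω i)) (sectorCenter n' (ω j)) ≤ Φ₀)) ∧
        (∀ x ∈ ({a, b, c} : Finset (Fin L)), FermiRG.torusDist (sectorCenter n' (ω x) - (sectorCenter n' (ω s) + σ)) ≤ 2 * Φ₀) ∧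
        ∃ k : Fin L → (Fin 2 → ℝ), (∀ i, k i ∈ sSector u e₀ n' (ω i : ℕ)) ∧ ∑ i, k i = R).card : ℝ)) ≤
      (2 * (L * (4 * c₃ * (2 : ℝ) ^ (-(n' : ℤ)))) / (s₁ / 2 * sectorWidth n') + 1) *
        (960 * Af * (2 * (L * (4 * c₃ * (2 : ℝ) ^ (-(n' : ℤ))) + Bf * (L * (4 * c₃ * (2 : ℝ) ^ (-(n' : ℤ))))) +
          (4 * Bf + 1) * (s₁ / 2 * sectorWidth n')) / cf ^ 2 / (s₁ / 2 * sectorWidth n') ^ 2) *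
      ((sectorCount n' : ℝ) * (2 * (2 * Φ₀ / sectorWidth n' + 1)) ^ (L - (E.card + 4))) := by
  set z : Fin (sectorCount n') := ⟨0, sectorCount_pos n'⟩ with hz
  set upd : (Fin L → Fin (sectorCount n')) → (Fin L → Fin (sectorCount n')) :=
    fun ω => Function.update (Function.update (Function.update ω a z) b z) c z with hupd
  set Cl := (Finset.univ : Finset (Fin L → Fin (sectorCount n'))).filter fun ω =>
        ((∀ e ∈ E, ω e = τ e) ∧ (∀ i j : Fin L, i ∉ E → j ∉ E → pairAngle (sectorCenter n' (ω i)) (sectorCenter n' (ω j)) ≤ Φ₀)) ∧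
        (∀ x ∈ ({a, b, c} : Finset (Fin L)), FermiRG.torusDist (sectorCenter n' (ω x) - (sectorCenter n' (ω s) + σ)) ≤ 2 * Φ₀) ∧
        ∃ k : Fin L → (Fin 2 → ℝ), (∀ i, k i ∈ sSector u e₀ n' (ω i : ℕ)) ∧ ∑ i, k i = R with hCl
  set Tb : ℝ := (2 * (L * (4 * c₃ * (2 : ℝ) ^ (-(n' : ℤ)))) / (s₁ / 2 * sectorWidth n') + 1) *
        (960 * Af * (2 * (L * (4 * c₃ * (2 : ℝ) ^ (-(n' : ℤ))) + Bf * (L * (4 * c₃ * (2 : ℝ) ^ (-(n' : ℤ))))) +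
          (4 * Bf + 1) * (s₁ / 2 * sectorWidth n')) / cf ^ 2 / (s₁ / 2 * sectorWidth n') ^ 2) with hTb
  have hw := sectorWidth_pos n'
  have hAf : 0 < Af := hcf.trans_le hcfA
  have hTb0 : 0 ≤ Tb := by rw [hTb]; positivity
  set K₀ : ℝ := 2 * (2 * Φ₀ / sectorWidth n' + 1) with hK₀
  have hK₀0 : 0 ≤ K₀ := by rw [hK₀]; positivity
  -- values of the projection
  have hupd_a : ∀ ω, upd ω a = z := fun ω => by
    rw [hupd]; simp only; rw [Function.update_of_ne hac, Function.update_of_ne hab, Function.update_self]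
  have hupd_b : ∀ ω, upd ω b = z := fun ω => by
    rw [hupd]; simp only; rw [Function.update_of_ne hbc, Function.update_self]
  have hupd_c : ∀ ω, upd ω c = z := fun ω => by
    rw [hupd]; simp only; rw [Function.update_self]
  have hupd_of_ne : ∀ ω i, i ≠ a → i ≠ b → i ≠ c → upd ω i = ω i := fun ω i hia' hib' hic' => by
    rw [hupd]; simp only; rw [Function.update_of_ne hic', Function.update_of_ne hib', Function.update_of_ne hia']
  -- the coordinate sets
  set cone : Fin (sectorCount n') → Finset (Fin (sectorCount n')) := fun m =>
    (Finset.univ : Finset (Fin (sectorCount n'))).filter fun x : Fin (sectorCount n') =>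
      pairAngle (sectorCenter n' x) (sectorCenter n' m) ≤ Φ₀ with hcone
  set B : Fin (sectorCount n') → Fin L → Finset (Fin (sectorCount n')) := fun m i =>
    if i = a ∨ i = b ∨ i = c then {z} else if i = s then {m} else if i ∈ E then {τ i} else cone m with hB
  set P := (Finset.univ : Finset (Fin L → Fin (sectorCount n'))).filter fun ρ => ∀ i, ρ i ∈ B (ρ s) i with hP
  -- the class projects into `P`
  have Hf : ∀ ω ∈ Cl, upd ω ∈ P := by
    intro ω hω
    rw [hCl, Finset.mem_filter] at hω
    obtain ⟨-, ⟨hωE, hnar⟩, -, -⟩ := hω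
    rw [hP, Finset.mem_filter]
    refine ⟨Finset.mem_univ _, fun i => ?_⟩
    have hs' : upd ω s = ω s := hupd_of_ne ω s hsa hsb hsc
    rw [hs', hB]; simp only
    by_cases hiabc : i = a ∨ i = b ∨ i = c
    · rw [if_pos hiabc, Finset.mem_singleton]
      rcases hiabc with h | h | h
      · rw [h]; exact hupd_a ω
      · rw [h]; exact hupd_b ω
      · rw [h]; exact hupd_c ω
    rw [if_neg hiabc]
    have hiabc' : i ≠ a ∧ i ≠ b ∧ i ≠ c := by
      refine ⟨fun h => hiabc (Or.inl h), fun h => hiabc (Or.inr (Or.inl h)), fun h => hiabc (Or.inr (Or.inr h))⟩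
    rw [hupd_of_ne ω i hiabc'.1 hiabc'.2.1 hiabc'.2.2]
    by_cases his' : i = s
    · rw [if_pos his', Finset.mem_singleton, his']
    rw [if_neg his']
    by_cases hiE : i ∈ E
    · rw [if_pos hiE, Finset.mem_singleton]; exact hωE i hiE
    rw [if_neg hiE, hcone, Finset.mem_filter]
    exact ⟨Finset.mem_univ _, hnar i s hiE hsE⟩
  -- every fibre over `P` has at most `⌊Tb⌋₊` elements
  have hn : ∀ ρ ∈ P, (Cl.filter fun ω => upd ω = ρ).card ≤ ⌊Tb⌋₊ := by
    intro ρ _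
    apply Nat.le_floor
    have h := card_classFibre_le_pred hD hc₃ h73 hs₁ hM₁ hΦ hcf hcfA hBf hchart
      (fun ω => (∀ e ∈ E, ω e = τ e) ∧ (∀ i j : Fin L, i ∉ E → j ∉ E → pairAngle (sectorCenter n' (ω i)) (sectorCenter n' (ω j)) ≤ Φ₀))
      s a b c hsa hsb hsc hab hac hbc R hΦ₀ h2Φ₀ σ hreg ρ
    rw [hTb]
    -- the fibre Finsets agree (only the `Decidable` instances of the two elaborations differ)
    convert h using 2
    · rfl
    · rfl
    · congr 1
      ext ω
      simp only [hCl, hupd, hz, Finset.mem_filter, Finset.mem_univ, true_and]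
  have h1 : Cl.card ≤ ⌊Tb⌋₊ * P.card := Finset.card_le_mul_card_image_of_maps_to Hf ⌊Tb⌋₊ hn
  -- `P` lies in a union of products
  have hPsub : P ⊆ (Finset.univ : Finset (Fin (sectorCount n'))).biUnion fun m => Fintype.piFinset (B m) := by
    intro ρ hρ
    rw [hP, Finset.mem_filter] at hρ
    rw [Finset.mem_biUnion]
    exact ⟨ρ s, Finset.mem_univ _, Fintype.mem_piFinset.2 hρ.2⟩
  -- the distinguished legs: `s, a, b, c` and the prescribed set `E`
  set A : Finset (Fin L) := insert s (insert a (insert b (insert c E))) with hA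
  have hAcard : A.card = E.card + 4 := by
    rw [hA, Finset.card_insert_of_notMem (by simp [hsa, hsb, hsc, hsE]), Finset.card_insert_of_notMem (by simp [hab, hac, haE]),
      Finset.card_insert_of_notMem (by simp [hbc, hbE]), Finset.card_insert_of_notMem hcE]
  have hAc : Aᶜ.card = L - (E.card + 4) := by rw [Finset.card_compl, hAcard, Fintype.card_fin]
  have hmemAc : ∀ i ∈ Aᶜ, i ∉ E ∧ i ≠ s ∧ i ≠ a ∧ i ≠ b ∧ i ≠ c := by
    intro i hi
    rw [Finset.mem_compl, hA] at hi
    simp only [Finset.mem_insert, not_or] at hi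
    exact ⟨hi.2.2.2.2, hi.1, hi.2.1, hi.2.2.1, hi.2.2.2.1⟩
  -- the product of the coordinate-set sizes
  have hprod : ∀ m, ((Fintype.piFinset (B m)).card : ℝ) ≤ K₀ ^ (L - (E.card + 4)) := by
    intro m
    rw [Fintype.card_piFinset, ← Finset.prod_mul_prod_compl A]
    have hA1 : ∏ i ∈ A, (B m i).card ≤ 1 := by
      have hle : ∀ i ∈ A, (B m i).card ≤ 1 := by
        intro i hi
        rw [hB]; simp only
        by_cases h1 : i = a ∨ i = b ∨ i = c
        · rw [if_pos h1, Finset.card_singleton]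
        rw [if_neg h1]
        by_cases h2 : i = s
        · rw [if_pos h2, Finset.card_singleton]
        rw [if_neg h2]
        by_cases h3 : i ∈ E
        · rw [if_pos h3, Finset.card_singleton]
        · exfalso
          rw [hA] at hi
          simp only [Finset.mem_insert] at hi
          rcases hi with h | h | h | h | h
          · exact h2 h
          · exact h1 (Or.inl h)
          · exact h1 (Or.inr (Or.inl h))
          · exact h1 (Or.inr (Or.inr h))
          · exact h3 h
      have h := Finset.prod_le_pow_card A (fun i => (B m i).card) 1 hle
      rwa [one_pow] at h
    have hA2 : ∏ i ∈ Aᶜ, (B m i).card = (cone m).card ^ (L - (E.card + 4)) := by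
      rw [← hAc, ← Finset.prod_const]
      refine Finset.prod_congr rfl fun i hi => ?_
      obtain ⟨h1, h2, h3, h4, h5⟩ := hmemAc i hi
      rw [hB]; simp only
      rw [if_neg (by rw [not_or, not_or]; exact ⟨h3, h4, h5⟩), if_neg h2, if_neg h1]
    have hcone_le : ((cone m).card : ℝ) ≤ K₀ := by
      rw [hcone, hK₀]; exact card_cone_pairAngle_le n' (sectorCenter n' m) Φ₀ hΦ₀
    have hcast : (((∏ i ∈ A, (B m i).card) * ∏ i ∈ Aᶜ, (B m i).card : ℕ) : ℝ) ≤ 1 * K₀ ^ (L - (E.card + 4)) := by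
      rw [hA2]; push_cast
      exact mul_le_mul (by exact_mod_cast hA1) (pow_le_pow_left₀ (Nat.cast_nonneg _) hcone_le _) (by positivity) zero_le_one
    rw [one_mul] at hcast
    exact hcast
  have hPcard : (P.card : ℝ) ≤ (sectorCount n' : ℝ) * K₀ ^ (L - (E.card + 4)) := by
    calc (P.card : ℝ) ≤ (((Finset.univ : Finset (Fin (sectorCount n'))).biUnion fun m => Fintype.piFinset (B m)).card : ℝ) := by
          exact_mod_cast Finset.card_le_card hPsub
      _ ≤ ∑ m : Fin (sectorCount n'), ((Fintype.piFinset (B m)).card : ℝ) := by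
          exact_mod_cast Finset.card_biUnion_le
      _ ≤ ∑ _m : Fin (sectorCount n'), K₀ ^ (L - (E.card + 4)) := Finset.sum_le_sum fun m _ => hprod m
      _ = (sectorCount n' : ℝ) * K₀ ^ (L - (E.card + 4)) := by
          rw [Finset.sum_const, nsmul_eq_mul, Finset.card_univ, Fintype.card_fin]
  -- assemble
  have h2 : (Cl.card : ℝ) ≤ (⌊Tb⌋₊ : ℝ) * (P.card : ℝ) := by exact_mod_cast h1
  have h3 : (⌊Tb⌋₊ : ℝ) ≤ Tb := Nat.floor_le hTb0
  calc (Cl.card : ℝ) ≤ (⌊Tb⌋₊ : ℝ) * (P.card : ℝ) := h2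
    _ ≤ Tb * ((sectorCount n' : ℝ) * K₀ ^ (L - (E.card + 4))) := mul_le_mul h3 hPcard (Nat.cast_nonneg _) hTb0

end Summit.HubbardSuperconductivity.HubbardSuperconductivity.Theorems.AbsUmklappCount

end
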